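import Summits.QuantumFields.YangMills.Theorems.UnitScaleTiltProp8HalvingFarDatum
import Summits.QuantumFields.YangMills.Theorems.UnitScaleTiltProp8FlatHScaledExtension
import HarnessLib

/-!
# Route `UnitScaleTilt`, crux K1 «MinimiserStabilityRegPr» (stmt-QuantumFields-19200), stub V2′ `stub_halvingStep` — the (H-E2E) census junctions, part 1 (★★OWNER ACK 28 (4)):
# **THE `bondAvgIter` ↔ `Qfun` CURRENCY SEAM, THE (155)-FAR ROW IN THE PACKAGE CURRENCY, AND THE TOP-LEVEL REDUCTION OF THE NEAR DATUM**

Cell `ym3-torus` (HUMAN RULING D-0037: YM₃ on the torus is ladder rung R3, not the Clay problem), width seat `ym-ust-19200-w8` g0∕s2.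
`--supports stmt-QuantumFields-19200 --as helper`; definition-free, 0 sorry.  Census memo `H-E2E-CENSUS-w8s2(-v2).md` (19200 evidence #53∕#55), rows S18∕S19.

WHAT THIS FILE PROVES (no definition, no sorry):
* §1 **`bondAvgIter_eq_sum_Qfun`** — `Q_{j(c)}(A′)(c) = Σ_b (Qfun D e_b)(c) • A′(b)` for matrix-valued fine fields: the (165) row ∕ package currency `bondAvgIter` versus
  ✓`HalvingFarDatum`'s `Qfun`-kernel currency (was not in the tree); **`far_bondAvgIter`** — the package's (155)-far clause on EVERY index bond of the cube sequence
  (top-level boundary-crossing bonds included) from the weighted (152)-size, `≤ (L·r)·L^{k−j(c)}` (✓`far_of_weighted152`, level-free).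
* §2 **`bondAvgIter_top_chartPreimage`** — by (45)♭ (spec (ii) of ✓`FlatHDressingShape.exists_flatH_scaledExt`, `Lᵏη = 1` at the top level) the near datum of the chart
  preimage `A′ = A + Hs X` on a top-level index bond is `Q_k(A)(c) + X(c)`; with `X = C♭ A` and CERT-2 this is `Q♭(A)(k,c)` — so the package's `hnear` asks exactly for the
  (160)-size of the double-bar TOP datum of the Thm-2 field (RULING g26-№13 (i), the D-P1 clause).
HONEST SCOPE.  Algebra and bookkeeping over landed letters; NOT a claim about the stub, the crux, the rung or the mass gap.

References: T. Bałaban, CMP **102** (1985) 277–309 [Balaban1985Variational] ((45) p.285, (152)–(157) pp.301–302, (160) p.303); CMP **96** (1984) 223–250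
[Balaban1984PropagatorsII] ((2.20) p.226).
-/

set_option autoImplicit false

noncomputable section

open scoped BigOperators Matrix.Norms.L2Operator

namespace Summit.QuantumFields.YangMills.Theorems.ChartBondAvgIterKernel

open Literature.MathematicalPhysics.QuantumFieldTheory.Balaban1983to89
open Literature.MathematicalPhysics.QuantumFieldTheory.Balaban1983to89.T3ContinuumYM3Torus
open B6SectADomainsV1 (Domains)
open B6SectAOperatorsV1 (BondIdx)
open LatticeFieldCalculus (bondAvgIter)
open FlatCubeOpsText (IsLevWeight)
open FlatCubeSequenceAligned (cubeSeqMT3)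
open FlatCubeSequenceAdm (adm22_cubeSeqMT3)

/-! ## §1 The currency seam and the (155)-far row -/

section Far

variable {F : T3Family} {n K : ℕ}

/-- **KERNEL IDENTITY (the currency seam of the far row)**: `Q_{j(c)}(A′)(c) = Σ_b (Qfun D e_b)(c) • A′(b)` for a matrix-valued fine field — the (165) row ∕ package
currency `bondAvgIter` versus ✓`HalvingFarDatum`'s `Qfun`-kernel currency. [cite: Balaban1984PropagatorsII, (2.20) p.226] -/
theorem bondAvgIter_eq_sum_Qfun (D : Domains (F.P K)) (A' : PBond (F.P K) 0 → Matrix (Fin 2) (Fin 2) ℂ) (c : BondIdx D) :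
    bondAvgIter (c.1.1 : ℕ) A' c.1.2 = ∑ b, FlatOpsLettersAssembly.Qfun D (Pi.single b 1) c • A' b := by
  classical
  have hA : A' = fun b' => ∑ b, (Pi.single b (1 : ℝ) : PBond (F.P K) 0 → ℝ) b' • A' b := by
    funext b'
    rw [Finset.sum_eq_single b' (fun b _ hb => by rw [Pi.single_eq_of_ne' hb, zero_smul]) (fun h => absurd (Finset.mem_univ _) h),
      Pi.single_eq_same, one_smul]
  conv_lhs => rw [hA]
  rw [ChartHInv.bondAvgIter_kernel_apply (fun b' b => (Pi.single b (1 : ℝ) : PBond (F.P K) 0 → ℝ) b') A' (c.1.1 : ℕ) c.1.2]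
  refine Finset.sum_congr rfl fun b _ => ?_
  rw [FlatOpsLettersAssembly.Qfun_apply, B6SectAOperatorsV1.QE_apply]

/-- **(155)-FAR IN THE PACKAGE CURRENCY, EVERY INDEX BOND** (top-level boundary-crossing bonds included): at the cube sequence with `R·M ≤ S`, `2L ≤ R·M` and the level
weights, a chart field `A′` of weighted (152)-size `r` has `‖Q_{j(c)}A′(c)‖ ≤ (L·r)·L^{k−j(c)}` — ✓`HalvingFarDatum.far_of_weighted152` through `bondAvgIter_eq_sum_Qfun`.
[cite: Balaban1985Variational, (152) p.301, (155)-(157) p.302] -/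
theorem far_bondAvgIter (x : Site (F.P K) 0) (ρ S M : ℕ) (hM : 1 ≤ M) {R : ℕ} (hRS : R * M ≤ S) (hRM : 2 * F.L ≤ R * M)
    {w : ℕ → PBond (F.P K) 0 → ℝ} (hw : IsLevWeight F n K (cubeSeqMT3 F n K x ρ S M hM) w) {r : ℝ}
    {A' : PBond (F.P K) 0 → Matrix (Fin 2) (Fin 2) ℂ} (hA' : ∀ b, w 1 b * ‖A' b‖ ≤ r) (c : BondIdx (cubeSeqMT3 F n K x ρ S M hM)) :
    ‖bondAvgIter (c.1.1 : ℕ) A' c.1.2‖ ≤ (F.L : ℝ) * r * (F.L : ℝ) ^ ((K - n) - (c.1.1 : ℕ)) :=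
  HalvingFarDatum.far_of_weighted152 rfl (adm22_cubeSeqMT3 F n K x ρ hM hRS) hRM hw (B := fun c => bondAvgIter (c.1.1 : ℕ) A' c.1.2)
    (fun c => bondAvgIter_eq_sum_Qfun _ A' c) hA' c

end Far

/-! ## §2 The near datum at the top level -/

section NearTop

variable {F : T3Family} {n K : ℕ}

/-- **TOP-LEVEL REDUCTION OF THE NEAR DATUM**: by (45)♭ (spec (ii) of ✓`exists_flatH_scaledExt`, level factor `Lᵏη = 1` at the top level) the package's near datum of
`A′ = A + Hs X` on a top-level index bond is `Q_k(A)(c) + X(c)` — for `X = C♭ A` this is `Q♭(A)(k,c) = −i·log U̿^{(k)}(e^{iηA})(c)` (CERT-2: the linear part of `Q♭` at the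
top level is `Q_k`), i.e. `hnear` asks EXACTLY for the (160)-size of the double-bar top datum of the Thm-2 chart field — RULING g26-№13 (i)'s D-P1 top clause.
[cite: Balaban1985Variational, (45) p.285, (156) p.302, (160) p.303] -/
theorem bondAvgIter_top_chartPreimage (D : Domains (F.P K))
    (Hs : (BondIdx D → Matrix (Fin 2) (Fin 2) ℂ) → (PBond (F.P K) 0 → Matrix (Fin 2) (Fin 2) ℂ))
    (hHinv : ∀ X (c : BondIdx D), ((F.L : ℝ) ^ (c.1.1 : ℕ) * ((F.L : ℝ)⁻¹) ^ (K - n)) • bondAvgIter (c.1.1 : ℕ) (Hs X) c.1.2 = X c)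
    (A : PBond (F.P K) 0 → Matrix (Fin 2) (Fin 2) ℂ) (X : BondIdx D → Matrix (Fin 2) (Fin 2) ℂ) (c : BondIdx D) (hc : (c.1.1 : ℕ) = K - n) :
    bondAvgIter (c.1.1 : ℕ) (A + Hs X) c.1.2 = bondAvgIter (c.1.1 : ℕ) A c.1.2 + X c := by
  have hL0 : (0 : ℝ) < (F.L : ℝ) := by exact_mod_cast (F.P K).L_pos
  have h1 : (F.L : ℝ) ^ (c.1.1 : ℕ) * ((F.L : ℝ)⁻¹) ^ (K - n) = 1 := by
    rw [hc, inv_pow, mul_inv_cancel₀ (pow_ne_zero _ hL0.ne')]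
  have h := hHinv X c
  rw [h1, one_smul] at h
  rw [Literature.MathematicalPhysics.QuantumFieldTheory.BalabanImbrieJaffe1984to88.BIJ85AxialPropagator411.bondAvgIter_add, Pi.add_apply, h]

end NearTop

end Summit.QuantumFields.YangMills.Theorems.ChartBondAvgIterKernel

end
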